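import Literature.Topology.FourManifolds.SeifertCircleMapProofs
import Literature.Topology.FourManifolds.BranchedDoubleCoverTwoKnot
import Literature.Geometry.Manifold.CoveringSpaceManifold
import HarnessLib

/-!
# The double cover of a space along a circle-valued map

Topic `Literature/Topology/FourManifolds`. For a topological space `Y` and a continuous map
`θ : Y → S¹` (`S¹ ⊆ ℝ²` the unit circle), the **double cover of `Y` along `θ`** is the
pull-back of the squaring cover `S¹ → S¹`, `z ↦ z²`:

  `DoubleCover θ = {(y, z) ∈ Y × S¹ | z² = θ y}`,   `proj (y, z) = y`,   `deck (y, z) = (y, -z)`.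

It is the 2-sheeted covering of `Y` classified by `θ_* : π₁(Y) → π₁(S¹) = ℤ → ℤ/2` (Hatcher,
*Algebraic Topology* (2002), §1.3, covering spaces via pull-back; the tree's infinite cyclic
cover `CircleMaps.CyclicCover` of `InfiniteCyclicCover.lean` is the analogous pull-back of
`exp : ℝ → S¹`). Its purpose here is the double cover of a 2-knot complement `S⁴ ∖ K(S²)` along
the circle-valued map of `CodimTwoCircleMap.lean` — the piece `Ỹ` of the branched double cover
`Σ₂(S⁴, K) = Ỹ ∪ (S² × ℝ²)` (Gompf–Stipsicz (1999), §6.3; `BranchedDoubleCoverTwoKnot.lean`).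

## Contents (everything proved; no named facts)

* `circleSq : S¹ → S¹`, `z ↦ z²` (the squaring map `normalSq` of `BranchedDoubleCoverTwoKnot.lean`
  restricted to the circle): fibres `{z, -z}` (`circleSq_eq_circleSq_iff`), `(e^{it})² = e^{2it}`
  (`circleSq_circlePoint`), onto, `C^∞`;
* `circleSqrt`, `circleSqrt'` — the two square roots `e^{i arg(ζ)/2}`, `e^{i arg'(ζ)/2}` built
  from the tree's plane angles `argE`, `argE'` (`SeifertCircleMapProofs.lean`): right inverses of
  `circleSq` everywhere, `C^∞` off the respective cut (`contMDiffAt_circleSqrt(')`);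
* `CircleMaps.DoubleCover θ` with `proj`, `sheet`, `deck`; the fibres of `proj` are the
  `deck`-orbits (`eq_or_eq_deck_of_proj_eq`), `deck` is a fixed-point-free involution, `proj` is
  onto; closed in `Y × S¹`, hence compact / Hausdorff / second countable with `Y`;
* `DoubleCover.isLocalHomeomorph_proj` — **`proj` is a local homeomorphism** (local sections
  `y ↦ (y, √(θ y))` through any point, using the square root smooth near `θ y₀` and the fact that
  the two square roots are at distance `2`);
* the **lifted `C^n` structure** (`Literature.Geometry.Manifold.liftChartedSpace`, Lee 2012,
  Prop. 4.40): `ChartedSpace`/`IsManifold` instances, `contMDiff_proj`, `contMDiff_deck`,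
  `contMDiffAt_of_comp_proj` (maps into the cover are `C^n` where their projection is),
  `isLocalDiffeomorph_proj`, and `contMDiffAt_sheet` (the sheet coordinate `S¹` is `C^n` when
  `θ` is).

## References

* A. Hatcher, *Algebraic Topology*, CUP (2002), §1.3. [HatcherAT2002]
* J. M. Lee, *Introduction to Smooth Manifolds*, 2nd ed. (2012), Prop. 4.40. [LeeSmoothManifolds2013]
* R. E. Gompf, A. I. Stipsicz, *4-Manifolds and Kirby Calculus* (1999), §6.3. [GompfStipsicz1999]
-/

open scoped Manifold ContDiff Topology
open Function Set Metric Complex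

noncomputable section

namespace Literature.Topology.FourManifolds

open Literature.Geometry.Manifold

/-- Local notation: `𝔼 n` is the model Euclidean space `EuclideanSpace ℝ (Fin n)`. -/
local notation "𝔼 " n:arg => EuclideanSpace ℝ (Fin n)

/-- Local notation: `𝕊 n` is the unit sphere in `EuclideanSpace ℝ (Fin (n + 1))`. -/
local notation "𝕊 " n:arg => (Metric.sphere (0 : EuclideanSpace ℝ (Fin (n + 1))) 1)

/-- `finrank ℝ ℝ² = 1 + 1` (spelling `Fin 2`), for the circle API. [folklore] -/
private theorem fact_finrank_two' : Fact (Module.finrank ℝ (EuclideanSpace ℝ (Fin 2)) = 1 + 1) :=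
  ⟨finrank_euclideanSpace_fin⟩

/-- `finrank ℝ ℝ² = 1 + 1` (spelling `Fin (1 + 1)`). [folklore] -/
private theorem fact_finrank_one_add_one' :
    Fact (Module.finrank ℝ (EuclideanSpace ℝ (Fin (1 + 1))) = 1 + 1) :=
  ⟨finrank_euclideanSpace_fin⟩

attribute [local instance] fact_finrank_two' fact_finrank_one_add_one'

/-! ### Squaring the circle -/

/-- `‖z²‖ = 1` for `z ∈ S¹`: `(u² - v²)² + (2uv)² = (u² + v²)² = 1`. [folklore] -/
theorem norm_normalSq_eq_one (z : 𝕊 1) : ‖normalSq (z : 𝔼 2)‖ = 1 := by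
  have hz : ‖(z : 𝔼 2)‖ ^ 2 = 1 := by rw [norm_eq_of_mem_sphere z, one_pow]
  rw [EuclideanSpace.real_norm_sq_eq, Fin.sum_univ_two] at hz
  have h1 : ‖normalSq (z : 𝔼 2)‖ ^ 2 = 1 := by
    rw [EuclideanSpace.real_norm_sq_eq, Fin.sum_univ_two, normalSq_apply_zero, normalSq_apply_one]
    nlinarith [hz]
  nlinarith [norm_nonneg (normalSq (z : 𝔼 2))]

/-- **The squaring map of the circle** `S¹ → S¹`, `z ↦ z²` (in real coordinates
`(u, v) ↦ (u² - v², 2uv)`, the restriction of `normalSq`). [folklore] -/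
def circleSq (z : 𝕊 1) : 𝕊 1 :=
  ⟨normalSq (z : 𝔼 2), mem_sphere_zero_iff_norm.2 (norm_normalSq_eq_one z)⟩

/-- `circleSq z = z²` as a vector. [folklore] -/
@[simp] theorem coe_circleSq (z : 𝕊 1) : (circleSq z : 𝔼 2) = normalSq (z : 𝔼 2) := rfl

/-- `(-z)² = z²`. [folklore] -/
@[simp] theorem circleSq_neg (z : 𝕊 1) : circleSq (-z) = circleSq z :=
  Subtype.ext (by rw [coe_circleSq, coe_circleSq, coe_neg_sphere, normalSq_neg])

/-- **The fibres of the squaring map are `{z, -z}`**: `z'² = z² ↔ z' = ±z`. [folklore] -/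
theorem circleSq_eq_circleSq_iff {z z' : 𝕊 1} : circleSq z' = circleSq z ↔ z' = z ∨ z' = -z := by
  rw [← Subtype.coe_inj, coe_circleSq, coe_circleSq, normalSq_eq_normalSq_iff, ← Subtype.coe_inj,
    ← Subtype.coe_inj (a := z'), coe_neg_sphere]

/-- `-z ≠ z` on the circle. [folklore] -/
theorem neg_ne_self_sphere (z : 𝕊 1) : -z ≠ z := by
  intro h
  have h' : -(z : EuclideanSpace ℝ (Fin (1 + 1))) = z := by rw [← coe_neg_sphere, h]
  have h2 : (2 : ℝ) • (z : EuclideanSpace ℝ (Fin (1 + 1))) = 0 := by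
    rw [two_smul]
    nth_rewrite 1 [← h']
    exact neg_add_cancel _
  rcases smul_eq_zero.1 h2 with h0 | h0
  · norm_num at h0
  · exact ne_zero_of_mem_unit_sphere z h0

/-- The two square roots are at distance `2`: `dist (-z) z = 2`. [folklore] -/
theorem dist_neg_self_sphere (z : 𝕊 1) : dist (-z) z = 2 := by
  have h : ((-z : 𝕊 1) : EuclideanSpace ℝ (Fin (1 + 1))) - (z : EuclideanSpace ℝ (Fin (1 + 1))) =
      -((2 : ℝ) • (z : EuclideanSpace ℝ (Fin (1 + 1)))) := by
    rw [coe_neg_sphere, two_smul, neg_add']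
  rw [Subtype.dist_eq, dist_eq_norm, h, norm_neg, norm_smul, Real.norm_two,
    norm_eq_of_mem_sphere z, mul_one]

/-- **`(e^{it})² = e^{2it}`.** [folklore] -/
theorem circleSq_circlePoint (t : ℝ) : circleSq (circlePoint t) = circlePoint (2 * t) := by
  apply Subtype.ext
  ext i
  fin_cases i
  · show Real.cos t ^ 2 - Real.sin t ^ 2 = Real.cos (2 * t)
    rw [Real.cos_two_mul]
    linarith [Real.sin_sq_add_cos_sq t]
  · show 2 * Real.cos t * Real.sin t = Real.sin (2 * t)
    rw [Real.sin_two_mul]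
    ring

/-- The squaring map of the circle is onto. [folklore] -/
theorem circleSq_surjective : Surjective circleSq := fun z ↦ by
  obtain ⟨t, rfl⟩ := circlePoint_surjective z
  exact ⟨circlePoint (t / 2), by rw [circleSq_circlePoint, mul_div_cancel₀ _ two_ne_zero]⟩

/-- The squaring map of the circle is continuous. [folklore] -/
theorem continuous_circleSq : Continuous circleSq :=
  (contDiff_normalSq.continuous.comp continuous_subtype_val).subtype_mk _

/-- The squaring map of the circle is `C^∞`. [folklore] -/
theorem contMDiff_circleSq : ContMDiff (𝓡 1) (𝓡 1) ∞ circleSq :=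
  (contDiff_normalSq.contMDiff.comp contMDiff_coe_sphere).codRestrict_sphere _

/-! ### The two smooth square roots -/

/-- The first square root `√ζ = e^{i arg(ζ)/2}` (`C^∞` off `ζ = -1`). [folklore] -/
def circleSqrt (ζ : 𝕊 1) : 𝕊 1 := circlePoint (argE (ζ : 𝔼 2) / 2)

/-- The second square root `e^{i arg'(ζ)/2}`, `arg' = arg(-·) + π` (`C^∞` off `ζ = 1`). [folklore] -/
def circleSqrt' (ζ : 𝕊 1) : 𝕊 1 := circlePoint (argE' (ζ : 𝔼 2) / 2)

/-- `(√ζ)² = ζ`. [folklore] -/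
@[simp] theorem circleSq_circleSqrt (ζ : 𝕊 1) : circleSq (circleSqrt ζ) = ζ := by
  rw [circleSqrt, circleSq_circlePoint, mul_div_cancel₀ _ two_ne_zero]
  apply Subtype.ext
  rw [coe_circlePoint_argE (ne_zero_of_mem_unit_sphere ζ), norm_eq_of_mem_sphere, inv_one,
    one_smul]

/-- `(√'ζ)² = ζ`. [folklore] -/
@[simp] theorem circleSq_circleSqrt' (ζ : 𝕊 1) : circleSq (circleSqrt' ζ) = ζ := by
  rw [circleSqrt', circleSq_circlePoint, mul_div_cancel₀ _ two_ne_zero]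
  apply Subtype.ext
  rw [coe_circlePoint_argE' (ne_zero_of_mem_unit_sphere ζ), norm_eq_of_mem_sphere, inv_one,
    one_smul]

/-- The first square root is `C^∞` off the cut `ζ = -1`. [folklore] -/
theorem contMDiffAt_circleSqrt {ζ : 𝕊 1} (h : toC (ζ : 𝔼 2) ∈ slitPlane) :
    ContMDiffAt (𝓡 1) (𝓡 1) ∞ circleSqrt ζ := by
  have h1 : ContMDiffAt (𝓡 1) 𝓘(ℝ, ℝ) ∞ (fun ξ : 𝕊 1 ↦ argE (ξ : 𝔼 2) / 2) ζ :=
    ((contDiffAt_argE h).div_const 2).contMDiffAt.comp ζ contMDiff_coe_sphere.contMDiffAt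
  exact contMDiff_circlePoint.contMDiffAt.comp ζ h1

/-- The second square root is `C^∞` off the cut `ζ = 1`. [folklore] -/
theorem contMDiffAt_circleSqrt' {ζ : 𝕊 1} (h : -toC (ζ : 𝔼 2) ∈ slitPlane) :
    ContMDiffAt (𝓡 1) (𝓡 1) ∞ circleSqrt' ζ := by
  have h1 : ContMDiffAt (𝓡 1) 𝓘(ℝ, ℝ) ∞ (fun ξ : 𝕊 1 ↦ argE' (ξ : 𝔼 2) / 2) ζ :=
    ((contDiffAt_argE' h).div_const 2).contMDiffAt.comp ζ contMDiff_coe_sphere.contMDiffAt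
  exact contMDiff_circlePoint.contMDiffAt.comp ζ h1

/-- **A smooth square root through any prescribed root.** For `z₀ ∈ S¹` there is a right
inverse `s` of the squaring map, `C^∞` (hence continuous) on an open set `V ∋ z₀²`, with
`s (z₀²) = z₀` (one of `±√`, `±√'` according to the cut avoiding `z₀²` and the sign of the root).
[folklore] -/
theorem exists_sqrt_nhds (z₀ : 𝕊 1) :
    ∃ (s : (𝕊 1) → 𝕊 1) (V : Set (𝕊 1)), IsOpen V ∧ circleSq z₀ ∈ V ∧
      (∀ ζ, circleSq (s ζ) = ζ) ∧ s (circleSq z₀) = z₀ ∧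
      ∀ ζ ∈ V, ContMDiffAt (𝓡 1) (𝓡 1) ∞ s ζ := by
  -- a square root `s₀` smooth near `z₀²`, with `s₀ (z₀²) = ± z₀`
  obtain ⟨s₀, V, hVo, hV0, hsq, hsm⟩ : ∃ (s₀ : (𝕊 1) → 𝕊 1) (V : Set (𝕊 1)), IsOpen V ∧
      circleSq z₀ ∈ V ∧ (∀ ζ, circleSq (s₀ ζ) = ζ) ∧ ∀ ζ ∈ V, ContMDiffAt (𝓡 1) (𝓡 1) ∞ s₀ ζ := by
    have hcont : Continuous fun ζ : 𝕊 1 ↦ toC (ζ : 𝔼 2) :=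
      contDiff_toC.continuous.comp continuous_subtype_val
    rcases toC_mem_slitPlane_or (ne_zero_of_mem_unit_sphere (circleSq z₀)) with h | h
    · exact ⟨circleSqrt, {ζ | toC (ζ : 𝔼 2) ∈ slitPlane}, isOpen_slitPlane.preimage hcont, h,
        circleSq_circleSqrt, fun ζ hζ ↦ contMDiffAt_circleSqrt hζ⟩
    · exact ⟨circleSqrt', {ζ | -toC (ζ : 𝔼 2) ∈ slitPlane}, isOpen_slitPlane.preimage hcont.neg,
        h, circleSq_circleSqrt', fun ζ hζ ↦ contMDiffAt_circleSqrt' hζ⟩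
  have hroot : s₀ (circleSq z₀) = z₀ ∨ s₀ (circleSq z₀) = -z₀ :=
    circleSq_eq_circleSq_iff.1 (hsq _)
  rcases hroot with h0 | h0
  · exact ⟨s₀, V, hVo, hV0, hsq, h0, hsm⟩
  · refine ⟨fun ζ ↦ -s₀ ζ, V, hVo, hV0, fun ζ ↦ by rw [circleSq_neg, hsq],
      by show -s₀ (circleSq z₀) = z₀; rw [h0, neg_neg], fun ζ hζ ↦ ?_⟩
    exact (contMDiff_neg_sphere (n := 1)).contMDiffAt.comp ζ (hsm ζ hζ)

/-! ### The double cover along a circle-valued map -/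

namespace CircleMaps

variable {Y : Type*} [TopologicalSpace Y]

/-- **The double cover of `Y` along `θ : Y → S¹`**: the pull-back `{(y, z) | z² = θ y}` of the
squaring cover of the circle (Hatcher (2002), §1.3; cf. `CircleMaps.CyclicCover`, the pull-back
of `exp`). [cite: HatcherAT2002, §1.3] -/
def DoubleCover (θ : C(Y, 𝕊 1)) : Type _ :=
  {p : Y × (𝕊 1) // circleSq p.2 = θ p.1}

namespace DoubleCover

variable {θ : C(Y, 𝕊 1)}

/-- The subspace topology from `Y × S¹`. [folklore] -/
instance instTopologicalSpace : TopologicalSpace (DoubleCover θ) :=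
  instTopologicalSpaceSubtype

/-- The covering projection `(y, z) ↦ y`. [cite: HatcherAT2002, §1.3] -/
def proj (p : DoubleCover θ) : Y := p.1.1

/-- The sheet coordinate `(y, z) ↦ z ∈ S¹` (a square root of `θ y`). [cite: HatcherAT2002, §1.3] -/
def sheet (p : DoubleCover θ) : 𝕊 1 := p.1.2

/-- The defining equation `z² = θ y`. [folklore] -/
theorem circleSq_sheet (p : DoubleCover θ) : circleSq (sheet p) = θ (proj p) := p.2

/-- Constructor. [folklore] -/
def mk (y : Y) (z : 𝕊 1) (h : circleSq z = θ y) : DoubleCover θ := ⟨(y, z), h⟩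

/-- `proj (y, z) = y`. [folklore] -/
@[simp] theorem proj_mk (y : Y) (z : 𝕊 1) (h : circleSq z = θ y) : proj (mk y z h) = y := rfl

/-- `sheet (y, z) = z`. [folklore] -/
@[simp] theorem sheet_mk (y : Y) (z : 𝕊 1) (h : circleSq z = θ y) : sheet (mk y z h) = z := rfl

/-- Points of the double cover are determined by their two coordinates. [folklore] -/
@[ext] theorem ext {p q : DoubleCover θ} (h₁ : proj p = proj q) (h₂ : sheet p = sheet q) : p = q :=
  Subtype.ext (Prod.ext h₁ h₂)

/-- **The deck transformation** `(y, z) ↦ (y, -z)`. [cite: HatcherAT2002, §1.3] -/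
def deck (p : DoubleCover θ) : DoubleCover θ :=
  mk (proj p) (-sheet p) (by rw [circleSq_neg, circleSq_sheet])

/-- `proj ∘ deck = proj`. [folklore] -/
@[simp] theorem proj_deck (p : DoubleCover θ) : proj (deck p) = proj p := rfl

/-- `sheet (deck p) = - sheet p`. [folklore] -/
@[simp] theorem sheet_deck (p : DoubleCover θ) : sheet (deck p) = -sheet p := rfl

/-- The deck transformation is an involution. [folklore] -/
@[simp] theorem deck_deck (p : DoubleCover θ) : deck (deck p) = p :=
  ext rfl (by rw [sheet_deck, sheet_deck, neg_neg])

/-- `deck ∘ deck = id`. [folklore] -/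
theorem deck_comp_deck : (deck ∘ deck : DoubleCover θ → DoubleCover θ) = id :=
  funext deck_deck

/-- The deck transformation is free. [folklore] -/
theorem deck_ne_self (p : DoubleCover θ) : deck p ≠ p := fun h ↦
  neg_ne_self_sphere (sheet p) (by rw [← sheet_deck, h])

/-- **The fibres of `proj` are the `deck`-orbits.** [cite: HatcherAT2002, §1.3] -/
theorem eq_or_eq_deck_of_proj_eq {p q : DoubleCover θ} (h : proj q = proj p) :
    q = p ∨ q = deck p := by
  have hs : circleSq (sheet q) = circleSq (sheet p) := by
    rw [circleSq_sheet, circleSq_sheet, h]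
  rcases circleSq_eq_circleSq_iff.1 hs with hz | hz
  · exact Or.inl (ext h hz)
  · exact Or.inr (ext h (by rw [sheet_deck, hz]))

/-- `proj q = proj p ↔ q ∈ {p, deck p}`. [folklore] -/
theorem proj_eq_iff {p q : DoubleCover θ} : proj q = proj p ↔ q = p ∨ q = deck p :=
  ⟨eq_or_eq_deck_of_proj_eq, by rintro (rfl | rfl) <;> simp⟩

/-- The projection is continuous. [folklore] -/
@[continuity, fun_prop]
theorem continuous_proj : Continuous (proj : DoubleCover θ → Y) :=
  continuous_fst.comp continuous_subtype_val

/-- The sheet coordinate is continuous. [folklore] -/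
@[continuity, fun_prop]
theorem continuous_sheet : Continuous (sheet : DoubleCover θ → 𝕊 1) :=
  continuous_snd.comp continuous_subtype_val

/-- The deck transformation is continuous. [folklore] -/
@[continuity, fun_prop]
theorem continuous_deck : Continuous (deck : DoubleCover θ → DoubleCover θ) :=
  (continuous_proj.prodMk continuous_sheet.neg).subtype_mk _

/-- The projection is onto (every `θ y` has a square root). [folklore] -/
theorem proj_surjective : Surjective (proj : DoubleCover θ → Y) := fun y ↦
  ⟨mk y (circleSqrt (θ y)) (circleSq_circleSqrt _), rfl⟩

/-- The fibre over `proj p` is `{p, deck p}`. [folklore] -/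
theorem preimage_singleton_eq (p : DoubleCover θ) : proj ⁻¹' {proj p} = {p, deck p} := by
  ext q
  simp only [mem_preimage, mem_singleton_iff, mem_insert_iff]
  exact proj_eq_iff

/-- The double cover is closed in `Y × S¹`. [folklore] -/
theorem isClosed_carrier : IsClosed {p : Y × (𝕊 1) | circleSq p.2 = θ p.1} :=
  isClosed_eq (continuous_circleSq.comp continuous_snd) (θ.continuous.comp continuous_fst)

/-- The double cover of a compact space is compact. [folklore] -/
instance instCompactSpace [CompactSpace Y] : CompactSpace (DoubleCover θ) :=
  isCompact_iff_compactSpace.1 (isClosed_carrier (θ := θ)).isCompact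

/-- The double cover of a Hausdorff space is Hausdorff. [folklore] -/
instance instT2Space [T2Space Y] : T2Space (DoubleCover θ) :=
  inferInstanceAs (T2Space {p : Y × (𝕊 1) // circleSq p.2 = θ p.1})

/-- The double cover of a second countable space is second countable. [folklore] -/
instance instSecondCountable [SecondCountableTopology Y] : SecondCountableTopology (DoubleCover θ) :=
  (Topology.IsEmbedding.subtypeVal
    (p := fun p : Y × (𝕊 1) ↦ circleSq p.2 = θ p.1)).secondCountableTopology

/-! ### Local sections; `proj` is a local homeomorphism -/

/-- **The local section through a point.** Given a right inverse `s` of the squaring map, smooth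
on an open `V`, the map `y ↦ (y, s (θ y))` inverts `proj` on the set of points of the cover over
`θ⁻¹(V)` whose sheet is the `s`-root; packaged as an open partial homeomorphism `proj|`.
[cite: HatcherAT2002, §1.3] -/
def sectionPiece (s : (𝕊 1) → 𝕊 1) (V : Set (𝕊 1)) (hVo : IsOpen V)
    (hsq : ∀ ζ, circleSq (s ζ) = ζ) (hsc : ContinuousOn s V) :
    OpenPartialHomeomorph (DoubleCover θ) Y where
  toFun := proj
  invFun y := mk y (s (θ y)) (hsq _)
  source := {p | θ (proj p) ∈ V ∧ sheet p = s (θ (proj p))}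
  target := θ ⁻¹' V
  map_source' p hp := hp.1
  map_target' y hy := ⟨hy, rfl⟩
  left_inv' p hp := ext rfl (by rw [sheet_mk]; exact hp.2.symm)
  right_inv' y _ := rfl
  open_source := by
    -- on the open set `{θ ∘ proj ∈ V}` the condition `sheet = s ∘ θ ∘ proj` reads `dist < 1`
    have hU : IsOpen {p : DoubleCover θ | θ (proj p) ∈ V} :=
      hVo.preimage (θ.continuous.comp continuous_proj)
    have hc : ContinuousOn (fun p : DoubleCover θ ↦ (sheet p, s (θ (proj p))))
        {p | θ (proj p) ∈ V} :=
      continuous_sheet.continuousOn.prodMk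
        (hsc.comp (θ.continuous.comp continuous_proj).continuousOn fun p hp ↦ hp)
    have heq : {p : DoubleCover θ | θ (proj p) ∈ V ∧ sheet p = s (θ (proj p))} =
        {p | θ (proj p) ∈ V} ∩
          (fun p : DoubleCover θ ↦ (sheet p, s (θ (proj p)))) ⁻¹' {q | dist q.1 q.2 < 1} := by
      ext p
      simp only [mem_setOf_eq, mem_inter_iff, mem_preimage]
      refine ⟨fun h ↦ ⟨h.1, by rw [h.2, dist_self]; exact one_pos⟩, fun h ↦ ⟨h.1, ?_⟩⟩
      have hs : circleSq (sheet p) = circleSq (s (θ (proj p))) := by rw [hsq, circleSq_sheet]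
      rcases circleSq_eq_circleSq_iff.1 hs with h' | h'
      · exact h'
      · exfalso
        have h2 := h.2
        rw [h', dist_neg_self_sphere] at h2
        norm_num at h2
    rw [heq]
    exact hc.isOpen_inter_preimage hU (isOpen_lt continuous_dist continuous_const)
  open_target := hVo.preimage θ.continuous
  continuousOn_toFun := continuous_proj.continuousOn
  continuousOn_invFun := by
    refine (Topology.IsInducing.subtypeVal.continuousOn_iff).2 ?_
    exact continuousOn_id.prodMk (hsc.comp θ.continuous.continuousOn fun y hy ↦ hy)

/-- The section piece is `proj` as a function. [folklore] -/
@[simp] theorem coe_sectionPiece (s : (𝕊 1) → 𝕊 1) (V : Set (𝕊 1)) (hVo : IsOpen V)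
    (hsq : ∀ ζ, circleSq (s ζ) = ζ) (hsc : ContinuousOn s V) :
    ⇑(sectionPiece (θ := θ) s V hVo hsq hsc) = proj := rfl

/-- **The projection of the double cover is a local homeomorphism.** [cite: HatcherAT2002, §1.3] -/
theorem isLocalHomeomorph_proj : IsLocalHomeomorph (proj : DoubleCover θ → Y) := by
  intro p₀
  obtain ⟨s, V, hVo, hV0, hsq, hs0, hsm⟩ := exists_sqrt_nhds (sheet p₀)
  have hsc : ContinuousOn s V := fun ζ hζ ↦ (hsm ζ hζ).continuousAt.continuousWithinAt
  refine ⟨sectionPiece s V hVo hsq hsc, ⟨?_, ?_⟩, rfl⟩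
  · show θ (proj p₀) ∈ V
    rw [← circleSq_sheet]
    exact hV0
  · show sheet p₀ = s (θ (proj p₀))
    rw [← circleSq_sheet, hs0]

/-! ### The lifted smooth structure -/

section Smooth

variable {H : Type*} [TopologicalSpace H] [ChartedSpace H Y]

/-- **The double cover of a charted space is a charted space** (lifted atlas along `proj`,
Lee 2012, Prop. 4.40). [cite: LeeSmoothManifolds2013, Prop. 4.40] -/
instance instChartedSpace : ChartedSpace H (DoubleCover θ) :=
  liftChartedSpace (isLocalHomeomorph_proj (θ := θ))

/-- The charts of the double cover are the lifted charts (by definition). [folklore] -/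
theorem chartAt_eq (p : DoubleCover θ) :
    chartAt H p = (coveringPiece (isLocalHomeomorph_proj (θ := θ)) p).trans
      (chartAt H (proj p)) := rfl

/-- The atlas of the double cover is the lifted atlas (by definition). [folklore] -/
theorem atlas_eq : atlas H (DoubleCover θ) = Set.range fun p : DoubleCover θ ↦
    (coveringPiece (isLocalHomeomorph_proj (θ := θ)) p).trans (chartAt H (proj p)) := rfl

variable {E : Type*} [NormedAddCommGroup E] [NormedSpace ℝ E] (I : ModelWithCorners ℝ E H)
  (n : ℕ∞ω)

/-- **The double cover of a `C^n` manifold is a `C^n` manifold** (Lee 2012, Prop. 4.40).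
[cite: LeeSmoothManifolds2013, Prop. 4.40] -/
instance instIsManifold [IsManifold I n Y] : IsManifold I n (DoubleCover θ) :=
  isManifold_of_atlas_eq_lift I n (isLocalHomeomorph_proj (θ := θ)) atlas_eq

variable {I n}

/-- **The projection is `C^n`.** [cite: LeeSmoothManifolds2013, Prop. 4.40] -/
theorem contMDiff_proj [IsManifold I n Y] : ContMDiff I I n (proj : DoubleCover θ → Y) :=
  contMDiff_proj_of_chartAt_eq (isLocalHomeomorph_proj (θ := θ)) chartAt_eq

/-- **The deck transformation is `C^n`.** [cite: LeeSmoothManifolds2013, Prop. 4.40 and Prop. 4.33] -/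
theorem contMDiff_deck [IsManifold I n Y] : ContMDiff I I n (deck : DoubleCover θ → DoubleCover θ) :=
  contMDiff_of_comp_proj_eq (isLocalHomeomorph_proj (θ := θ)) chartAt_eq continuous_deck
    (funext proj_deck)

/-- A continuous map into the double cover is `C^n` where its projection is (smooth lifting
criterion). [cite: LeeSmoothManifolds2013, Prop. 4.40 and Prop. 4.33] -/
theorem contMDiffAt_of_comp_proj [IsManifold I n Y]
    {E' : Type*} [NormedAddCommGroup E'] [NormedSpace ℝ E'] {H' : Type*} [TopologicalSpace H']
    {J : ModelWithCorners ℝ E' H'} {X : Type*} [TopologicalSpace X] [ChartedSpace H' X]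
    {φ : X → DoubleCover θ} {x : X} (hφ : ContinuousAt φ x)
    (h : ContMDiffAt J I n (proj ∘ φ) x) : ContMDiffAt J I n φ x :=
  Literature.Geometry.Manifold.contMDiffAt_of_comp_proj (isLocalHomeomorph_proj (θ := θ))
    chartAt_eq hφ h

/-- **The projection is a local `C^n` diffeomorphism.** [cite: LeeSmoothManifolds2013, Prop. 4.33 (a)] -/
theorem isLocalDiffeomorph_proj [IsManifold I n Y] :
    IsLocalDiffeomorph I I n (proj : DoubleCover θ → Y) :=
  isLocalDiffeomorph_proj_of_chartAt_eq (isLocalHomeomorph_proj (θ := θ)) chartAt_eq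

/-- The differentials of the projection are bijective (`n ≠ 0`). [cite: LeeSmoothManifolds2013, Prop. 4.33 (a)] -/
theorem bijective_mfderiv_proj [IsManifold I n Y] (hn : n ≠ 0) (p : DoubleCover θ) :
    Bijective (mfderiv I I (proj : DoubleCover θ → Y) p) :=
  bijective_mfderiv_proj_of_chartAt_eq (isLocalHomeomorph_proj (θ := θ)) chartAt_eq hn p

/-- **The sheet coordinate is `C^n` when `θ` is**: near any point `sheet = s ∘ θ ∘ proj` for a
square root `s` smooth near `θ (proj p)` — the sheet, being a continuous square root of
`θ ∘ proj`, agrees with `s ∘ θ ∘ proj` on a neighbourhood. [folklore] -/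
theorem contMDiffAt_sheet [IsManifold I ∞ Y] (hθ : ContMDiff I (𝓡 1) ∞ θ) (p₀ : DoubleCover θ) :
    ContMDiffAt I (𝓡 1) ∞ (sheet : DoubleCover θ → 𝕊 1) p₀ := by
  obtain ⟨s, V, hVo, hV0, hsq, hs0, hsm⟩ := exists_sqrt_nhds (sheet p₀)
  have hsc : ContinuousOn s V := fun ζ hζ ↦ (hsm ζ hζ).continuousAt.continuousWithinAt
  have hθp : θ (proj p₀) = circleSq (sheet p₀) := (circleSq_sheet p₀).symm
  -- `s ∘ θ ∘ proj` is `C^∞` at `p₀`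
  have h1 : ContMDiffAt I (𝓡 1) ∞ (fun p : DoubleCover θ ↦ s (θ (proj p))) p₀ := by
    have hs : ContMDiffAt (𝓡 1) (𝓡 1) ∞ s (θ (proj p₀)) := by
      rw [hθp]; exact hsm _ hV0
    exact hs.comp p₀ ((hθ _).comp p₀ contMDiff_proj.contMDiffAt)
  -- and agrees with `sheet` near `p₀` (on the source of the section piece)
  refine h1.congr_of_eventuallyEq ?_
  have hmem : p₀ ∈ (sectionPiece (θ := θ) s V hVo hsq hsc).source :=
    ⟨by show θ (proj p₀) ∈ V; rw [hθp]; exact hV0, by show sheet p₀ = s (θ (proj p₀)); rw [hθp, hs0]⟩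
  filter_upwards [(sectionPiece (θ := θ) s V hVo hsq hsc).open_source.mem_nhds hmem] with p hp
  exact hp.2

end Smooth

end DoubleCover

end CircleMaps

end Literature.Topology.FourManifolds
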